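import Summits.ResolutionOfSingularities.ResolutionOfSingularities.Theorems.EquisingularLiftEquisingularLiftNatTowerBTriplePrimeAssemblyFull
import Summits.ResolutionOfSingularities.ResolutionOfSingularities.Theorems.EquisingularLiftEquisingularLiftNatReachTowerBTriplePrimePointResolutionOfSubchainLift
import Summits.ResolutionOfSingularities.ResolutionOfSingularities.Theorems.EquisingularLiftEquisingularLiftNatConeTowerPointResolutionThreeOfCech
import Summits.ResolutionOfSingularities.ResolutionOfSingularities.Theorems.EquisingularLiftEquisingularLiftNatTCPlusInvBaseSL
import HarnessLib

/-!
# [OURS · L1 W4.5(b) · EL♮(3)] RUNG DEF-TOWER-B‴ AT `n = 3` (rung⁗) — the T23-A‴ rung target `stub_elnat_defTowerBTriplePrimePointResolutionThree`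
# (TARGET⁗ = res-L1-w45b-lead-2 g6's `t23at/sig/TARGET-stub_elnat_defTowerBTriplePrimePointResolutionThree.sig.txt` e612240447fe2fa3 = rung‴ p621675 under the
# ONE-token map `ReachTowerBDoublePrimeS ↦ ReachTowerBTriplePrime`), CLOSED over the fact (T-k) `EmbeddedCurveLiftFact` — helper lane (engine-green swap: the 33rd registration DERIVES it)

res-L1-w45b-stub-2 g13 on the desk's R28 DEAL («stub-2: instance⁗ + rung⁗ (U7)»). OURS; NOT a statement of any manuscript ([Hironaka2017] is a candidate under
adjudication, nothing of it is asserted); AI-written, weaker than expert review. No `sorry`; standard axioms; DEF-FREE. `--supports stmt-ResolutionOfSingularities-20148 --as helper`.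
PROOF = p621675 verbatim with the B‴ names: instance⁗ `stub_elnat_defTowerBTriplePrimePointResolution_of_subchainLiftBTriplePrime` (p628534) ∘ the A‴ engine
`hsub_reachTowerBTriplePrime_of_fact_full` (res-L1-w45b-stub-4, V10⁗-full `…NatTowerBTriplePrimeAssemblyFull`) ∘ (T-k) `hFact k O θ hθ P q`, with its ONE base
input `hBaseSL` discharged by res-type-027's `inv_baseSL` (…NatTCPlusInvBaseSL), in characteristic `p` of `k`.
-/

set_option linter.dupNamespace false -- mandated namespace `Summit.<Summit>.<Problem>` of this single-conjunct summit
set_option linter.overlappingInstances false -- signatures carry `[IsDomain O] [IsDiscreteValuationRing O]`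

noncomputable section

open CategoryTheory CategoryTheory.Limits AlgebraicGeometry TopologicalSpace Topology IsLocalRing
open Literature.AlgebraicGeometry.Resolution
open AlgebraicGeometry.Scheme.IdealSheafData
open Summit.ResolutionOfSingularities.ResolutionOfSingularities.Theses.EquisingularLift.Split
open Summit.ResolutionOfSingularities.ResolutionOfSingularities.Cruxes.EquisingularLift.StrataSplit

namespace Summit.ResolutionOfSingularities.ResolutionOfSingularities.Cruxes.EquisingularLiftNat.Sections

/-- **RUNG DEF-TOWER-B‴ at `n = 3` (rung⁗)** — the T23-A‴ rung target (TARGET⁗ e612240447fe2fa3 = rung‴ under `ReachTowerBDoublePrimeS ↦ ReachTowerBTriplePrime`; to be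
DERIVED by the T23-A‴ registration) over its first binder (T-k). See the module docstring. [folklore; pure composition] [OURS · L1 W4.5b] -/
theorem stub_elnat_defTowerBTriplePrimePointResolutionThree (p : ℕ) : EmbeddedCurveLiftFact → p.Prime → ∀ (k : Type) [Field k] [CharP k p] [IsAlgClosed k] (H : AlgebraicGeometry.Scheme.{0}) (ι : H ⟶ (Literature.AlgebraicGeometry.Motives.projectiveSpace 3 k).left), AlgebraicGeometry.IsClosedImmersion ι → AlgebraicGeometry.IsIntegral H → (∀ y : (Literature.AlgebraicGeometry.Motives.projectiveSpace 3 k).left, ∃ U : (Literature.AlgebraicGeometry.Motives.projectiveSpace 3 k).left.affineOpens, y ∈ (U : (Literature.AlgebraicGeometry.Motives.projectiveSpace 3 k).left.Opens) ∧ (ι.ker.ideal U).IsPrincipal) → (∃ (F' : AlgebraicGeometry.Scheme.{0}) (ρ' : F' ⟶ (Literature.AlgebraicGeometry.Motives.projectiveSpace 3 k).left) (T' : Set F'), (∀ Q : (∀ F₁ : AlgebraicGeometry.Scheme.{0}, (F₁ ⟶ (Literature.AlgebraicGeometry.Motives.projectiveSpace 3 k).left) → Set F₁ → Prop), Q (Literature.AlgebraicGeometry.Motives.projectiveSpace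 3 k).left (CategoryTheory.CategoryStruct.id (Literature.AlgebraicGeometry.Motives.projectiveSpace 3 k).left) (Set.range ι) → (∀ (F₁ F₂ : AlgebraicGeometry.Scheme.{0}) (ρ : F₁ ⟶ (Literature.AlgebraicGeometry.Motives.projectiveSpace 3 k).left) (T₁ : Set F₁) (x : ↥(AlgebraicGeometry.Scheme.IdealSheafData.vanishingIdeal (⟨closure T₁, isClosed_closure⟩ : TopologicalSpace.Closeds F₁)).subscheme) (υ : F₂ ⟶ F₁) (hx : IsClosed ({((AlgebraicGeometry.Scheme.IdealSheafData.vanishingIdeal (⟨closure T₁, isClosed_closure⟩ : TopologicalSpace.Closeds F₁)).subschemeι x : F₁)} : Set F₁)), Q F₁ ρ T₁ → ¬ IsRegularLocalRing ((AlgebraicGeometry.Scheme.IdealSheafData.vanishingIdeal (⟨closure T₁, isClosed_closure⟩ : TopologicalSpace.Closeds F₁)).subscheme.presheaf.stalk x) → IsRegularLocalRing (F₁.presheaf.stalk ((AlgebraicGeometry.Scheme.IdealSheafData.vanishingIdeal (⟨closure T₁, isClosed_closure⟩ : TopologicalSpace.Closeds F₁)).subschemeι x)) → Literature.AlgebraicGeometry.Resolution.IsBlowup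 υ (AlgebraicGeometry.Scheme.IdealSheafData.vanishingIdeal (⟨{((AlgebraicGeometry.Scheme.IdealSheafData.vanishingIdeal (⟨closure T₁, isClosed_closure⟩ : TopologicalSpace.Closeds F₁)).subschemeι x : F₁)}, hx⟩ : TopologicalSpace.Closeds F₁)) → Q F₂ (CategoryTheory.CategoryStruct.comp υ ρ) (closure (υ ⁻¹' (T₁ \ {((AlgebraicGeometry.Scheme.IdealSheafData.vanishingIdeal (⟨closure T₁, isClosed_closure⟩ : TopologicalSpace.Closeds F₁)).subschemeι x : F₁)}))) ∧ (∀ (F₉ : AlgebraicGeometry.Scheme.{0}) (β : F₉ ⟶ F₂) (T₉ : Set F₉), ReachTowerBTriplePrime F₁ F₂ υ ((AlgebraicGeometry.Scheme.IdealSheafData.vanishingIdeal (⟨closure T₁, isClosed_closure⟩ : TopologicalSpace.Closeds F₁)).subschemeι x) (closure (υ ⁻¹' (T₁ \ {((AlgebraicGeometry.Scheme.IdealSheafData.vanishingIdeal (⟨closure T₁, isClosed_closure⟩ : TopologicalSpace.Closeds F₁)).subschemeι x : F₁)}))) F₉ β T₉ → Q F₉ (CategoryTheory.CategoryStruct.comp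 (CategoryTheory.CategoryStruct.comp β υ) ρ) T₉)) → Q F' ρ' T') ∧ Literature.AlgebraicGeometry.Resolution.Scheme.IsRegular (AlgebraicGeometry.Scheme.IdealSheafData.vanishingIdeal (⟨closure T', isClosed_closure⟩ : TopologicalSpace.Closeds F')).subscheme) → ∃ (O : Type) (_ : CommRing O) (_ : IsDomain O) (_ : IsDiscreteValuationRing O) (_ : CharZero O) (π : O →+* k), Function.Surjective π ∧ (letI := MvPolynomial.gradedAlgebra (σ := Fin (3 + 1)) (R := O); letI := MvPolynomial.gradedAlgebra (σ := Fin (3 + 1)) (R := k); ∀ (φ : MvPolynomial.homogeneousSubmodule (Fin (3 + 1)) O →+*ᵍ MvPolynomial.homogeneousSubmodule (Fin (3 + 1)) k) (hφ' : HomogeneousIdeal.irrelevant (MvPolynomial.homogeneousSubmodule (Fin (3 + 1)) k) ≤ (HomogeneousIdeal.irrelevant (MvPolynomial.homogeneousSubmodule (Fin (3 + 1)) O)).map φ), (∀ s, φ s = MvPolynomial.map π s) → ∀ Y : Set (AlgebraicGeometry.Proj (MvPolynomial.homogeneousSubmodule (Fin (3 + 1)) O)), Y = Set.range (CategoryTheory.CategoryStruct.comp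 ι (AlgebraicGeometry.Proj.map φ hφ') : H ⟶ (AlgebraicGeometry.Proj (MvPolynomial.homogeneousSubmodule (Fin (3 + 1)) O))) → ∃ (P' : AlgebraicGeometry.Scheme.{0}) (σ : P' ⟶ (AlgebraicGeometry.Proj (MvPolynomial.homogeneousSubmodule (Fin (3 + 1)) O))) (S' : Set P'), (∀ Q : (∀ X' : AlgebraicGeometry.Scheme.{0}, (X' ⟶ (AlgebraicGeometry.Proj (MvPolynomial.homogeneousSubmodule (Fin (3 + 1)) O))) → Set X' → Prop), Q (AlgebraicGeometry.Proj (MvPolynomial.homogeneousSubmodule (Fin (3 + 1)) O)) (CategoryTheory.CategoryStruct.id (AlgebraicGeometry.Proj (MvPolynomial.homogeneousSubmodule (Fin (3 + 1)) O))) Y → (∀ (X' X'' : AlgebraicGeometry.Scheme.{0}) (σ' : X' ⟶ (AlgebraicGeometry.Proj (MvPolynomial.homogeneousSubmodule (Fin (3 + 1)) O))) (Y' : Set X') (C : X'.IdealSheafData) (τ : X'' ⟶ X'), Q X' σ' Y' → Literature.AlgebraicGeometry.Resolution.IsBlowup τ C → Literature.AlgebraicGeometry.Resolution.Scheme.IsRegular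 C.subscheme → AlgebraicGeometry.Flat (CategoryTheory.CategoryStruct.comp C.subschemeι (CategoryTheory.CategoryStruct.comp σ' (CategoryTheory.CategoryStruct.comp (AlgebraicGeometry.Proj.toSpecZero (MvPolynomial.homogeneousSubmodule (Fin (3 + 1)) O)) (AlgebraicGeometry.Spec.map (CommRingCat.ofHom (algebraMap O (MvPolynomial.homogeneousSubmodule (Fin (3 + 1)) O 0))))))) → σ' '' (C.support : Set X') ⊆ {x | ¬ IsGenericPoint x Y} → (C.support : Set X') ∩ (CategoryTheory.CategoryStruct.comp σ' (CategoryTheory.CategoryStruct.comp (AlgebraicGeometry.Proj.toSpecZero (MvPolynomial.homogeneousSubmodule (Fin (3 + 1)) O)) (AlgebraicGeometry.Spec.map (CommRingCat.ofHom (algebraMap O (MvPolynomial.homogeneousSubmodule (Fin (3 + 1)) O 0)))))) ⁻¹' {IsLocalRing.closedPoint O} ⊆ Y' → Q X'' (CategoryTheory.CategoryStruct.comp τ σ') (closure (τ ⁻¹' (Y' \ (C.support : Set X'))))) → Q P' σ S') ∧ Literature.AlgebraicGeometry.Resolution.Scheme.IsRegular (AlgebraicGeometry.Scheme.IdealSheafData.vanishingIdeal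 (⟨closure S', isClosed_closure⟩ : TopologicalSpace.Closeds P')).subscheme) := by
  intro hFact hp k _ _ _ H ι hι hH hloc hres
  exact stub_elnat_defTowerBTriplePrimePointResolution_of_subchainLiftBTriplePrime p hp k 3 H ι hι hH hloc
    (fun O _ _ _ _ _ θ hθ P q Y Ch hChStep hChSplit hYsp hYirr hYcl hPint hPnoeth hPreg hqprop hqsm X' σ' S' hCh' hX'int hX'noeth hX'reg hX'dom F₁ hF₁ j t
        hsq T₁ hT₁cl hT₁irr hjT₁ x hx U hU s hs hsU hsx hdim hxreg hsoff X₁ τ₁ hτ₁ hX₁int hX₁noeth hX₁reg hX₁dom F₂ hF₂ υ hυ j₂ t₂ hsq₂ hcomm hcarrier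
        hirr₂ hCh₁ =>
      hsub_reachTowerBTriplePrime_of_fact_full k O θ hθ P q Y Ch hChStep hChSplit hYsp hYirr hYcl hPint hPnoeth hPreg hqprop hqsm X' σ' S' hCh' hX'int hX'noeth
        hX'reg hX'dom F₁ hF₁ j t hsq T₁ hT₁cl hT₁irr hjT₁ x hx U hU s hs hsU hsx hdim hxreg hsoff X₁ τ₁ hτ₁ hX₁int hX₁noeth hX₁reg hX₁dom F₂ hF₂ υ hυ
        j₂ t₂ hsq₂ hcomm hcarrier hirr₂ hCh₁ (hFact k O θ hθ P q)
        -- the SL-BASE (plane list seeded `[υ⁻¹{x}]`, conical `W`): res-type-027's `inv_baseSL` (A‴ (U6)), in characteristic `p` of `k`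
        (fun W _ hnot _ hcone => by
          haveI : Fact p.Prime := ⟨hp⟩
          haveI := hqprop; haveI := hX'int; haveI := hX'noeth; haveI := hF₁; haveI := hX₁int; haveI := hX₁noeth; haveI := hF₂
          exact inv_baseSL p k O θ hθ P q Y Ch hChSplit hPnoeth hPreg X' σ' S' hCh' hX'reg F₁ j t hsq T₁ x hx hxreg U hU s hs hsU hsx hdim hsoff X₁
            τ₁ hτ₁ hX₁reg hX₁dom F₂ υ hυ j₂ t₂ hsq₂ hcomm hcarrier hCh₁ hirr₂ W hnot hcone))
    hres

end Summit.ResolutionOfSingularities.ResolutionOfSingularities.Cruxes.EquisingularLiftNat.Sections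

end
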